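import Summits.MatrixMultiplication.OmegaCensus.STPPThinFamilies

/-!
# ω-census (abelian STPP census, seat stpp-2), filter N7 part 4: sub-format monotonicity of `R(⟨k,m,n⟩)` and the kernel-grade table

HONEST FRAMING (pub-omega census; verbatim): lottery ticket; floor = certified bounds/negative ranges.
Census BOOKKEEPING (pub-omega stpp-2 gen 16, 2026-08-26; referee g190 / lead L27-7 (6) caveat 'sub-format monotonicity lemma'):
the engine-of-record census filter N7 (census.py v0.10, mode `kernel`) bounds the rank of a fat block `⟨a,b,c⟩` below by the
best tree border rank of a SUB-FORMAT (`patterns.rank_single_lb`: zero-padding a sub-format is a restriction).  This file puts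
that step in the kernel, so that the engine's kernel-grade table is literally a tree theorem for EVERY fat format:

* `STPPRank.tensorRank_matMulTensor_mono` — `k ≤ k' → m ≤ m' → n ≤ n' → R(⟨k,m,n⟩) ≤ R(⟨k',m',n'⟩)` over any commutative
  semiring (Bläser 2013, Lemma 5.4 on the coordinate embeddings; the tree had the square case `Blaser2013_rank_matMulTensor_mono`);
* `STPPRank.rlbKernel a b c` — the engine's kernel-grade single-block table as a function of the format: `14` if the sorted format
  dominates `(2,3,3)`, else `10` if it dominates `(2,2,3)`, else `7` if it dominates `(2,2,2)`, else `0`;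
  `STPPRank.rlbKernel_le_tensorRank` — `rlbKernel a b c ≤ R(⟨a,b,c⟩)` over `ℂ` (tree border ranks `7 / 10 / 14` +
  `Blaser2013_lemma55` + monotonicity);
* `STPPRank.rlbKernel_add_sum_gain_le_card_of_isSTPP` — filter N7 with one distinguished fat block of ANY format:
  `rlbKernel(|A_{j₀}|,|B_{j₀}|,|C_{j₀}|) + ∑_{i ≠ j₀} gain(dᵢ; |Aᵢ|,|Bᵢ|,|Cᵢ|) ≤ |H|`.
Nothing here is progress on `ω`.
-/

noncomputable section

open scoped BigOperators

namespace Summit.MatrixMultiplication.OmegaCensus.STPPRank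

open Literature.Computability.AlgebraicComplexity Module Finset

/-! ## Sub-format monotonicity -/

section Mono

variable (K : Type*) [CommSemiring K]

/-- Zero-padding: for `k ≤ k'`, `m ≤ m'`, `n ≤ n'`, `⟨k,m,n⟩` is `⟨k',m',n'⟩` precomposed with the coordinate embeddings
(Bläser 2013, Def. 7.2 / Lemma 5.4). [cite: Blaser2013, Lemma 5.4] -/
theorem matMulTensor_eq_precomp_castLE₃ {k m n k' m' n' : ℕ} (hk : k ≤ k') (hm : m ≤ m') (hn : n ≤ n') :
    matMulTensor K k m n = fun a b c =>
      matMulTensor K k' m' n' (Prod.map (Fin.castLE hk) (Fin.castLE hn) a)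
        (Prod.map (Fin.castLE hk) (Fin.castLE hm) b) (Prod.map (Fin.castLE hm) (Fin.castLE hn) c) := by
  funext a b c
  simp [matMulTensor, Prod.map, Fin.ext_iff]

/-- **Sub-format monotonicity of the rank of matrix multiplication**: `k ≤ k'`, `m ≤ m'`, `n ≤ n'` imply
`R(⟨k,m,n⟩) ≤ R(⟨k',m',n'⟩)` (restriction along coordinate projections). [cite: Blaser2013, Lemma 5.4] -/
theorem tensorRank_matMulTensor_mono {k m n k' m' n' : ℕ} (hk : k ≤ k') (hm : m ≤ m') (hn : n ≤ n') :
    tensorRank (matMulTensor K k m n) ≤ tensorRank (matMulTensor K k' m' n') := by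
  rw [matMulTensor_eq_precomp_castLE₃ K hk hm hn]
  exact tensorRank_precomp_le _ _ _ _

end Mono

/-! ## The kernel-grade single-block table of filter N7 -/

section Table

/-- The engine's kernel-grade lower-bound table for `R(⟨a,b,c⟩)` as a function of the (unsorted) format: with
`s₁ ≤ s₂ ≤ s₃` the sorted format, `14` if `(2,3,3) ≤ (s₁,s₂,s₃)`, else `10` if `(2,2,3) ≤ (s₁,s₂,s₃)`, else `7` if
`(2,2,2) ≤ (s₁,s₂,s₃)`, else `0` (`patterns.N7_KERNEL_RLB` + `rank_single_lb`, census.py v0.10). [folklore] -/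
def rlbKernel (a b c : ℕ) : ℕ :=
  if 2 ≤ min a (min b c) ∧ 3 ≤ max (min a b) (min (max a b) c) ∧ 3 ≤ max a (max b c) then 14
  else if 2 ≤ min a (min b c) ∧ 3 ≤ max a (max b c) then 10
  else if 2 ≤ min a (min b c) then 7 else 0

/-- `R(⟨a,b,c⟩) ≥ 7` over `ℂ` as soon as `a, b, c ≥ 2` (contains `⟨2,2,2⟩`). [cite: Landsberg2005, main theorem (p. 447)] -/
theorem seven_le_tensorRank_matMulTensor_of_two_le {a b c : ℕ} (ha : 2 ≤ a) (hb : 2 ≤ b) (hc : 2 ≤ c) :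
    7 ≤ tensorRank (matMulTensor ℂ a b c) :=
  seven_le_tensorRank_matMulTensor_222.trans (tensorRank_matMulTensor_mono ℂ ha hb hc)

/-- `R(⟨a,b,c⟩) ≥ 10` over `ℂ` as soon as `a, b, c ≥ 2` and one of them is `≥ 3` (contains a permutation of `⟨2,2,3⟩`).
[cite: ConnerHarperLandsberg2023, Thm. 1.3] -/
theorem ten_le_tensorRank_matMulTensor_of_le {a b c : ℕ} (ha : 2 ≤ a) (hb : 2 ≤ b) (hc : 2 ≤ c)
    (h3 : 3 ≤ a ∨ 3 ≤ b ∨ 3 ≤ c) : 10 ≤ tensorRank (matMulTensor ℂ a b c) := by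
  obtain ⟨h223, h232, h322⟩ := ten_le_tensorRank_matMulTensor_223_perm
  rcases h3 with h | h | h
  · exact h322.trans (tensorRank_matMulTensor_mono ℂ h hb hc)
  · exact h232.trans (tensorRank_matMulTensor_mono ℂ ha h hc)
  · exact h223.trans (tensorRank_matMulTensor_mono ℂ ha hb h)

/-- `R(⟨a,b,c⟩) ≥ 14` over `ℂ` as soon as `a, b, c ≥ 2` and two of them are `≥ 3` (contains a permutation of `⟨2,3,3⟩`).
[cite: Blaser2013, Lemma 5.5] -/
theorem fourteen_le_tensorRank_matMulTensor_of_le {a b c : ℕ} (ha : 2 ≤ a) (hb : 2 ≤ b) (hc : 2 ≤ c)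
    (h33 : (3 ≤ a ∧ 3 ≤ b) ∨ (3 ≤ a ∧ 3 ≤ c) ∨ (3 ≤ b ∧ 3 ≤ c)) : 14 ≤ tensorRank (matMulTensor ℂ a b c) := by
  obtain ⟨h233, h323, h332⟩ := fourteen_le_tensorRank_matMulTensor_233_perm
  rcases h33 with ⟨h1, h2⟩ | ⟨h1, h2⟩ | ⟨h1, h2⟩
  · exact h332.trans (tensorRank_matMulTensor_mono ℂ h1 h2 hc)
  · exact h323.trans (tensorRank_matMulTensor_mono ℂ h1 hb h2)
  · exact h233.trans (tensorRank_matMulTensor_mono ℂ ha h1 h2)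

/-- **The kernel-grade table is a tree theorem for every format**: `rlbKernel a b c ≤ R(⟨a,b,c⟩)` over `ℂ`.
[cite: Blaser2013, Lemma 5.4] -/
theorem rlbKernel_le_tensorRank (a b c : ℕ) : rlbKernel a b c ≤ tensorRank (matMulTensor ℂ a b c) := by
  unfold rlbKernel
  split_ifs with h14 h10 h7
  · obtain ⟨hmin, hmid, _⟩ := h14
    have ha : 2 ≤ a := le_trans hmin (min_le_left _ _)
    have hb : 2 ≤ b := le_trans hmin ((min_le_right _ _).trans (min_le_left _ _))
    have hc : 2 ≤ c := le_trans hmin ((min_le_right _ _).trans (min_le_right _ _))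
    refine fourteen_le_tensorRank_matMulTensor_of_le ha hb hc ?_
    -- `3 ≤ max (min a b) (min (max a b) c)` says: two of a, b, c are ≥ 3
    rcases le_max_iff.mp hmid with h | h
    · exact Or.inl ⟨le_trans h (min_le_left _ _), le_trans h (min_le_right _ _)⟩
    · have hc3 : 3 ≤ c := le_trans h (min_le_right _ _)
      have hab : 3 ≤ max a b := le_trans h (min_le_left _ _)
      rcases le_max_iff.mp hab with h' | h'
      · exact Or.inr (Or.inl ⟨h', hc3⟩)
      · exact Or.inr (Or.inr ⟨h', hc3⟩)
  · obtain ⟨hmin, hmax⟩ := h10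
    have ha : 2 ≤ a := le_trans hmin (min_le_left _ _)
    have hb : 2 ≤ b := le_trans hmin ((min_le_right _ _).trans (min_le_left _ _))
    have hc : 2 ≤ c := le_trans hmin ((min_le_right _ _).trans (min_le_right _ _))
    refine ten_le_tensorRank_matMulTensor_of_le ha hb hc ?_
    rcases le_max_iff.mp hmax with h | h
    · exact Or.inl h
    · rcases le_max_iff.mp h with h' | h'
      · exact Or.inr (Or.inl h')
      · exact Or.inr (Or.inr h')
  · have ha : 2 ≤ a := le_trans h7 (min_le_left _ _)
    have hb : 2 ≤ b := le_trans h7 ((min_le_right _ _).trans (min_le_left _ _))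
    have hc : 2 ≤ c := le_trans h7 ((min_le_right _ _).trans (min_le_right _ _))
    exact seven_le_tensorRank_matMulTensor_of_two_le ha hb hc
  · exact Nat.zero_le _

/-- Sanity values of the table (the engine's `N7_KERNEL_RLB` rows and two monotone consequences). [folklore] -/
theorem rlbKernel_values :
    rlbKernel 2 2 2 = 7 ∧ rlbKernel 2 2 3 = 10 ∧ rlbKernel 3 2 2 = 10 ∧ rlbKernel 2 3 3 = 14 ∧ rlbKernel 3 3 3 = 14 ∧
      rlbKernel 2 2 4 = 10 ∧ rlbKernel 4 2 2 = 10 ∧ rlbKernel 3 3 5 = 14 ∧ rlbKernel 1 4 4 = 0 := by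
  decide

end Table

/-! ## Filter N7 with a distinguished fat block of any format (kernel grade) -/

section STPP

variable {H : Type*} [AddCommGroup H] [Fintype H] [DecidableEq H] {N : ℕ}

/-- **Filter N7, kernel grade, any distinguished block:** for an STPP family with non-empty sets in a finite abelian `H`,
a block `j₀` and directions `d` for the others, `rlbKernel(|A_{j₀}|,|B_{j₀}|,|C_{j₀}|) + ∑_{i ≠ j₀} gain(dᵢ;|Aᵢ|,|Bᵢ|,|Cᵢ|) ≤ |H|`
— exactly the `kernel`-mode single-block bound of census engine v0.10 (`patterns.rank_single_lb` with format monotonicity).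
[cite: CohnKleinbergSzegedyUmans2005, Thm. 5.5] [cite: BuczynskiPostinghelRupniewski2020, §3.1 (first Lemma)] -/
theorem rlbKernel_add_sum_gain_le_card_of_isSTPP (A B C : Fin N → Finset H) (hS : IsSTPP A B C)
    (hne : ∀ i, (A i).Nonempty ∧ (B i).Nonempty ∧ (C i).Nonempty) (d : Fin N → Fin 3) (j₀ : Fin N) :
    rlbKernel (A j₀).card (B j₀).card (C j₀).card +
        ∑ i ∈ Finset.univ.erase j₀, gain (d i) (A i).card (B i).card (C i).card ≤ Fintype.card H := by
  have h := tensorRank_add_sum_gain_le_card_of_isSTPP A B C hS hne d j₀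
  have ht := rlbKernel_le_tensorRank (A j₀).card (B j₀).card (C j₀).card
  omega

end STPP

end Summit.MatrixMultiplication.OmegaCensus.STPPRank

end
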